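import Literature.MathematicalPhysics.QuantumFieldTheory.Balaban1983to89.B8Thm2TorusCoverOfDeltaAAssembler
import Literature.MathematicalPhysics.QuantumFieldTheory.Balaban1983to89.B9Thm310DeltaAAtMemberOfCubeData
import Literature.MathematicalPhysics.QuantumFieldTheory.Balaban1983to89.B9Thm39ReadingCoords

/-!
# [B8] Theorem 2 on the torus, cover form, with the per-member binder (1ₛ) ∧ (Eₛ) DISCHARGED — the LAST JUNCTION of sub-row G-B8-T2S
# «[B8] §3 Thm 2 TORUS SUPPLIER» (seat t2s-1 gen 24): ONE application of `B8Thm2TorusCoverOfDeltaAAssembler.hThm2Cover_of_prop6_deltaAAssembler`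
# (t2s-1 g17) to the bond-sector member assembler `B9Thm310DeltaAAtMemberOfCubeData.deltaA_at_member_of_cubeData_two` (p38 g49 over p33 g105's road)

T. Bałaban, *Spaces of regular gauge field configurations on a lattice and gauge fixing conditions*, Commun. Math. Phys. **99** (1985) 75–102
[`Balaban1985RegularSpaces`, "[B8]"]: Thm 2 p. 83, (1.33)–(1.39) pp. 82–83, (1.7)–(1.8) p. 77 (the regime `𝔄_k`), Prop. 6 (1.135)–(1.138) p. 99.
T. Bałaban, *Propagators for lattice gauge theories in a background field*, Commun. Math. Phys. **99** (1985) 389–434 [`Balaban1985BackgroundPropagators`,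
"[B9]"]: Thm 3.3 p. 399 (the propagator `G = Δ_a⁻¹`, (3.42) p. 397) via Thm 3.10 pp. 414–416 ((3.105)–(3.106) p. 414), (3.35)–(3.37) p. 396 (the cube class),
Cor. 3.6 p. 408, (3.69) p. 404.  [4] = [`Balaban1984PropagatorsII`] Lemma 2.1 (2.60)–(2.63) p. 234.

statement-level skeleton of published theorems with citation tags; proofs where landed; nothing here is a claim about the Yang–Mills mass gap

WHY THIS FILE (cell `lit-balaban`; seat t2s-1 gen 24, lead WORDS T2S-7 ∕ T2S-8).  t2s-1 g17's `hThm2Cover_of_prop6_deltaAAssembler` (p700891) proved the torus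
Thm 2 cover form of record (`B8Thm2TorusCoverGCOfProp6.hThm2Cover_of_prop6_deltaAMembers`, t2s-1 g12) FROM ANY bond-sector member assembler of a fixed TARGET
SIGNATURE, displayed as its hypothesis: at every shape member above thresholds, from Cor. 3.6's per-cube (3.35) data and a (3.69)-type plaquette datum,
(1ₛ) `IsUnit Δ_a(U; parSymY)` and (Eₛ) the (3.42) block of `G_a = Δ_a⁻¹` for every background family through `U` ([B9] Thm 3.3 via Thm 3.10 at the member).
That assembler now EXISTS in the tree in exactly this signature: `B9Thm310DeltaAAtMemberOfCubeData.deltaA_at_member_of_cubeData_two` (p38 g49, the last file of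
p33 g105's ASSEMBLER ROAD P2 `B9Eq3105FamTwoAtMember` → P3 `B9Eq3105FamThreeAtMember` → H `B9CubeDataHermitianPart` → ASM1-R `B9Eq3105RestAtMember` ∕ ASM1-V
`B9Eq3105RestTAtMember` → ASM2, over module M5.7's endpoint `B9Thm310DeltaAIsUnitOfExpansion.eBlock_kernelFamilyBInv_GAY_of_localInverseCubes''` ∕
`isUnit_deltaAY_of_localInverse`).  THIS FILE is the sub-row's LAST JUNCTION: the one application, so that the torus [B8] Thm 2 cover form is a theorem whose
only displayed inputs are the record's outer sockets and numeric windows — NO per-member analytic statement and NO assembler hypothesis.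

WHAT THIS FILE PROVES (ONE THEOREM; 0 `def`, 0 `def … : Prop`, 0 sorry; standard axioms).
* ★★★★★ `hThm2Cover_of_prop6_deltaA` — for `4 ≤ ℓ` (`L = ℓ + 1` odd), `τ = tr` on `M₂(ℂ)` (cyclic, with a Cauchy–Schwarz constant `C_τ`), `1 ≤ M`, `0 < α < 1`
  (FILE 4's (2.61) dimension parameter) and a length function `len` — NOTHING ELSE displayed:
  `∃ δ_E > 0, ∃ d′ A₀, ∀ a′ ≥ A₀, ∃ c_P > 0, ∃ B_E > 0, ∃ a_J > 0, ∀ a_T ⟨FILE 4 ∕ F7 windows⟩, a_T ≤ c_P → ∀ α₀′ ⟨class windows⟩ → ∃ a₀′ k₀ c_α, ∀ c_L ⟨windows⟩,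
  ∃ B₁ B₂ c₁ > 0, ∀ F n K, n < K → P ∣ P′ ∧ L^{K−n} ∣ P ∧ Thm2TorusAt (ℓ+1) (K−n) P′ (eta F n K) 0 B₁ B₂ c₁ len SU(2) ⊤`
  — the conclusion of `hThm2Cover_of_prop6_deltaAAssembler` VERBATIM, its hypothesis supplied by `deltaA_at_member_of_cubeData_two`; the record's
  walk-letter parameters `Rr Hp Hg` and the real basis `b` of `M₂(ℂ)` with its coordinate bound `M₂` (binders of p700891 that its conclusion never mentions)
  are instantiated INSIDE: `Rr := 0`, `Hp := Hg := True`, `b := Module.finBasis ℝ M₂(ℂ)` with `M₂ := coordBound39 b` by n06-j's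
  `B9Thm39ReadingCoords.abs_repr_le` (finite dimension).  PROOF = `hThm2Cover_of_prop6_deltaAAssembler … (deltaA_at_member_of_cubeData_two …)`
  (p38 g49 kernel-checked the application in scratch before filing ASM2; the basis instantiation was kernel-checked by t2s-1 g24 against p700891).

HONEST SCOPE.  Assembly of two landed theorems, nothing else; every estimate of print used on the way is inside the two inputs and their imports ([B8] Prop. 6
through pub-ymgap's `prop6At_bgZd_allTorus_holds` and t2s-1 g9 ∕ g12; the regime (1.7) plaquette datum through t2s-1 g8; [B9] Thm 3.10 ⇒ Thm 3.3 for `Δ_a⁻¹`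
through M5.7 and the four (3.105) family records of the p33 ∕ p38 ∕ p21 ∕ r06 lanes).  The numeric windows displayed are the record's and are jointly inhabited
for any positive parameters (`B8Thm2TorusCoverGCOfProp6.exists_admissible_sizes_below`).  `Thm2TorusAt` is [B8] Thm 2's torus statement in the tree's letter
(sub-problem node of `stmt-QuantumFields-19200`); `stub_PV3A` is NOT discharged by this file; no summit ∕ node statement is proved here; nothing continuum ∕ ℝ⁴ ∕
OS — the Yang–Mills mass gap is NOT proved by any of this.  `--supports stmt-QuantumFields-19200`.
RELATED, NOT DUPLICATED (searched 2026-08-29: `lean search 'hThm2Cover_of_prop6_deltaA$|TorusCoverOfProp6DeltaA' --decl` ∅; `rg -l "deltaA_at_member_of_cubeData_two"`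
over Literature ∕ Summits = the defining ASM2 file only; `rg -l "hThm2Cover_of_prop6_deltaAAssembler"` = p700891 only).
-/

noncomputable section

namespace Literature.MathematicalPhysics.QuantumFieldTheory.Balaban1983to89.B8Thm2TorusCoverOfProp6DeltaA

open scoped BigOperators Matrix Matrix.Norms.L2Operator
open Node00 B6KLevelCensusIndexV1
open B7Prop1Explicit renaming Site → LSite
open B7Prop2Explicit (C0 c2')
open B6GlobalChartV1 (PV)
open B9GeoNormsKLevelV1 (geo9K)
open B9Eq316AveragingTransposeZd (betaTau alphaQ)
open B7Prop2SpecialUnitary (specialUnitaryUnits)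
open B8Thm2TorusAt (Thm2TorusAt)
open T3ContinuumYM3Torus (T3Family)
open T3SectALandauChart (eta)
open B8Thm2TorusCoverOfDeltaAAssembler (hThm2Cover_of_prop6_deltaAAssembler)
open B9Thm310DeltaAAtMemberOfCubeData (deltaA_at_member_of_cubeData_two)
open B9Thm39ReadingCoords (abs_repr_le)

variable {ℓ : ℕ} {hL : Odd (ℓ + 1) ∧ 1 < ℓ + 1} {hd₃ : 1 ≤ 2 + 1}
variable [instF : ∀ i : KIdx 2 ℓ hd₃ hL 1 1, Fintype (geo9K i).Site] [instD : ∀ i : KIdx 2 ℓ hd₃ hL 1 1, DecidableEq (geo9K i).Site]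

/-- ★★★★★ **[B8] THEOREM 2 ON THE TORUS, COVER FORM — PER-MEMBER BINDER DISCHARGED** (`d + 1 = 3`, `N = 2`, `G = U(2)`; the LAST JUNCTION of sub-row G-B8-T2S).
For `4 ≤ ℓ`, `τ = tr` (cyclic, Cauchy–Schwarz constant `C_τ`), `1 ≤ M`, `0 < α < 1` and `len` (nothing else displayed): `∃ δ_E > 0, ∃ d′ A₀, ∀ a′ ≥ A₀, ∃ c_P > 0, ∃ B_E > 0, ∃ a_J > 0, ∀ a_T ⟨windows⟩, a_T ≤ c_P → ∀ α₀′ ⟨windows⟩ → ∃ a₀′ k₀ c_α,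
∀ c_L ⟨windows⟩, ∃ B₁ B₂ c₁ > 0, ∀ F n K, n < K → P ∣ P′ ∧ L^{K−n} ∣ P ∧ Thm2TorusAt (ℓ+1) (K−n) P′ (eta F n K) 0 B₁ B₂ c₁ len SU(2) ⊤` — the conclusion of
t2s-1 g17's `hThm2Cover_of_prop6_deltaAAssembler` VERBATIM with its displayed assembler hypothesis SUPPLIED by p38 g49's
`B9Thm310DeltaAAtMemberOfCubeData.deltaA_at_member_of_cubeData_two` ([B9] Thm 3.3 for `G = Δ_a⁻¹` via Thm 3.10 at the member from Cor. 3.6's cube data: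
(1ₛ) `IsUnit Δ_a(U; parSymY)` ∧ (Eₛ) the (3.42) block of `kernelFamilyBInv … (GAY i parSymY parBY G′)`, member-free rate and constant); the record's
walk-letter parameters `Rr Hp Hg` and real basis `b` of `M₂(ℂ)` (never mentioned by the conclusion) are instantiated inside (`0`, `True`, `True`,
`Module.finBasis` with `B9Thm39ReadingCoords.abs_repr_le`).  PROOF: one application.
HONEST SCOPE: assembly only; the numeric windows are the record's (jointly inhabited by `B8Thm2TorusCoverGCOfProp6.exists_admissible_sizes_below`); `stub_PV3A`
NOT discharged; no summit ∕ node statement proved; nothing continuum ∕ ℝ⁴ ∕ OS — the Yang–Mills mass gap is NOT proved by any of this.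
[cite: Balaban1985RegularSpaces, Thm 2 p.83, (1.33)–(1.39) pp.82–83, (1.7)–(1.8) p.77, Prop. 6 (1.135)–(1.138) p.99; Balaban1985BackgroundPropagators, Thm 3.3 p.399 via Thm 3.10 pp.414–416, (3.42) p.397, (3.35)–(3.37) p.396, Cor. 3.6 p.408, (3.69) p.404, (3.105)–(3.106) p.414; Balaban1984PropagatorsII, Lemma 2.1 (2.60)–(2.63) p.234] -/
theorem hThm2Cover_of_prop6_deltaA (hℓ : 4 ≤ ℓ)
    (τ : (Matrix (Fin 2) (Fin 2) ℂ) →ₗ[ℂ] ℂ) (hτ : ∀ a, τ a = Matrix.trace a) (hτt : ∀ a b, τ (a * b) = τ (b * a))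
    {Cτ : ℝ} (hCτ : ∀ x y : (Matrix (Fin 2) (Fin 2) ℂ), |(τ (star x * y)).re| ≤ Cτ * ‖x‖ * ‖y‖)
    {M : ℝ} (hM1 : 1 ≤ M) {α : ℝ} (hαE0 : 0 < α) (hα1 : α < 1)
    {len : LSite (2 + 1) → ℝ} :
    letI : CStarAlgebra (Matrix (Fin 2) (Fin 2) ℂ) := {}
    ∃ δE : ℝ, 0 < δE ∧ ∃ d' A₀ : ℕ, ∀ a' : ℕ, A₀ ≤ a' → ∃ cP : ℝ, 0 < cP ∧ ∃ BE : ℝ, 0 < BE ∧ ∃ aJ : ℝ, 0 < aJ ∧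
    ∀ aT : ℝ, 0 < aT → aT ≤ alphaQ (2 + 1) (ℓ + 1) / ((ℓ + 1 : ℕ) : ℝ) ^ 2 → C0 (2 + 1) * aT ≤ 1 / 3 → 2 * aT ≤ c2' (2 + 1) (ℓ + 1) →
      2 * ((48 * (((2 : ℕ) : ℝ) + 1) + 14 * ((2 : ℕ) : ℝ) * M + (32 * (((2 : ℕ) : ℝ) + 2) ^ 2 +
        12 * (((2 : ℕ) : ℝ) + 1) ^ 2 * (13344 * (((2 : ℕ) : ℝ) + 1) * (((2 : ℕ) : ℝ) + 2) ^ 2 * (((2 : ℕ) : ℝ) + 5) * (((ℓ + 1 : ℕ) : ℝ)) ^ (2 + 4)) *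
          (Cτ * betaTau τ))) * aT) * (2 * (BE * B6.c1 d' δE (1 - α) * (((ℓ + 1 : ℕ) : ℝ)) ^ 4)) ≤ 1 →
      aT ≤ cP →
    ∀ α₀' : ℝ, 0 < α₀' → α₀' ≤ aJ → C0 (2 + 1) * α₀' ≤ 1 / 3 → 2 * α₀' ≤ c2' (2 + 1) (ℓ + 1) → aT * (((ℓ + 1 : ℕ) : ℝ)) ^ (2 * 1) < α₀' →
    ∃ a₀' : ℝ, 0 < a₀' ∧ ∃ k₀ : ℕ, ∃ cα : ℝ, 0 < cα ∧
    ∀ cL : ℝ, 0 < cL → cL * (((ℓ + 1 : ℕ) : ℝ)) ^ 2 < a₀' →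
      cL ≤ min (1 / 16) (min aT (min aT (1 / (2 * (2 * (2 * (BE * B6.c1 d' δE (1 - α) * (((ℓ + 1 : ℕ) : ℝ)) ^ 4))) * (14 * ((2 + 1 - 1 : ℕ) : ℝ)) * M + 1)))) →
      cL ≤ cα →
    ∃ B₁' B₂ c₁ : ℝ, 0 < B₁' ∧ 0 < B₂ ∧ 0 < c₁ ∧
    ∀ F : T3Family, F.L = ℓ + 1 → ∀ (n K : ℕ), n < K →
      (((F.P K).sitesPerDir 0 : ℕ) : ℤ) ∣ (((PV 2 ℓ (F.m + k₀) K hd₃ hL).sitesPerDir 0 : ℕ) : ℤ) ∧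
      (((ℓ + 1 : ℕ) : ℤ)) ^ (K - n) ∣ (((F.P K).sitesPerDir 0 : ℕ) : ℤ) ∧
      Thm2TorusAt (ℓ + 1) (K - n) ((((PV 2 ℓ (F.m + k₀) K hd₃ hL).sitesPerDir 0 : ℕ) : ℤ)) (eta F n K) 0 B₁' B₂ c₁ len
        (specialUnitaryUnits (Fin 2)) (fun _ => True) :=
  -- the walk-letter parameters `Rr Hp Hg` and the real basis `b` of `M₂(ℂ)` (with its coordinate bound) never occur in the conclusion: instantiate them here
  hThm2Cover_of_prop6_deltaAAssembler (hd₃ := hd₃) (hL := hL) (len := len) hℓ τ hτ hτt hCτ hM1 hαE0 hα1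
    (Module.finBasis ℝ (Matrix (Fin 2) (Fin 2) ℂ)) (norm_nonneg _) (abs_repr_le _) 0 True True
    (deltaA_at_member_of_cubeData_two (hd₃ := hd₃) (hL := hL) (Module.finBasis ℝ (Matrix (Fin 2) (Fin 2) ℂ)) (by omega)
      (norm_nonneg _) (abs_repr_le _))

end Literature.MathematicalPhysics.QuantumFieldTheory.Balaban1983to89.B8Thm2TorusCoverOfProp6DeltaA

end
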